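import Summits.MatrixMultiplication.MatrixMultiplication.Theorems.ObstructionDescentBlockRestriction

set_option linter.dupNamespace false

/-!
# The fibre law: a doubly isolated index hides its third-slot fibre (decomp-mm · lens 3 · gen 14, part F)

Route `route-MatrixMultiplication-ObstructionDescent`, support for the aside `InvariantSaturation` (item
`stmt-MatrixMultiplication-32282`).  Hand law H15a of NODE-g14 §2(vii), now kernel.

SETTING.  Fix an index `i₀ : Fin m` and call a tensor `x ∈ ℂ^m ⊗ ℂ^m ⊗ ℂ^m` DOUBLY ISOLATED AT `i₀`
(`twoSlotIsolated m i₀`) if every non-zero entry `x_{abc}` with `a = i₀` or `b = i₀` is the diagonal entry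
`x_{i₀i₀i₀}`; the entries `x_{ab i₀}` with `a, b ≠ i₀` — the FIBRE over `i₀` in the third slot — are free.
Example (the census's T17b′ seeds): `⟨m⟩ + Σ_r u_r ⊗ v_r ⊗ w_r` with `(u_r)_{i₀} = (v_r)_{i₀} = 0` and dense `w_r`.

* **H15a (fibre law, `evalT_zeroFibre`).**  Every weight vector `f ∈ hwvSpace Λ d` whose weights at `i₀` in
  slots `0` and `2` agree (`Λ 0 i₀ = Λ 2 i₀`; automatic for the rectangular types `rectType m N k`) takes the
  same value at `x` and at `zeroFibre i₀ x` (the fibre set to zero):  `f(x) = f(zeroFibre i₀ x)`.  Hence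
  (`pointLevels_zeroFibre`) `E′_N(x) = E′_N(zeroFibre i₀ x)`, and for `i₀ = m-1` the tensor `zeroFibre i₀ x` is a
  genuine `((m-1),1)`-BLOCK point (`zeroFibre_mem_blockDiag_one`): doubly isolated points are block points in
  disguise, and every block law (H13 `restrictB_mem_hwvSpace`, (PP) `evalT_eq_zero_of_twinBlocks`, …) applies to them.
* PROOF (weight counting, as a torus computation).  Let `D_λ = diag(1,…,λ,…,1)` (`λ ≠ 0` at position `i₀`,
  `fibreTorus`).  On a doubly isolated `x` the identity `(1,1,D_λ)·x = (D_λ,1,1)·(scaleFibre i₀ λ x)` holds entrywise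
  (`actTensor_fibreTorus_eq`; `scaleFibre` multiplies the fibre by `λ`), so Borel semi-invariance gives
  `λ^{Λ₂(i₀)} f(x) = λ^{Λ₀(i₀)} f(scaleFibre i₀ λ x)`, i.e. `f(scaleFibre i₀ λ x) = f(x)` for all `λ ≠ 0`
  (`evalT_scaleFibre`); `λ ↦ f(scaleFibre i₀ λ x)` is a one-variable polynomial (`MvPolynomial.aeval` into `ℂ[X]`),
  constant on `ℂ∖{0}`, hence constant (`Polynomial.eq_zero_of_infinite_isRoot`), and its value at `λ = 0` is
  `f(zeroFibre i₀ x)`.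
* CENSUS READING.  With `m = N = 5`, `k = 3`: the T17b′ zeros `H₅(⟨5⟩ + T + T′) = 0` at seeds with
  `u_{i₀} = v_{i₀} = 0` are values of `H₅` at `(4,1)`-block points, where level `3` is dead by propagated parity —
  they say nothing about `σ₇(5³)`; the generic test is T17b″.
[cite: BurgisserIkenmeyer2011, §3.1–3.2] (weight vectors as Borel eigenvectors), [cite: BurgisserIkenmeyer2017, §5 (5.2), Thm 5.3]
(the level sets `E′`).
-/

open scoped BigOperators
open Finset

namespace Summit.MatrixMultiplication.MatrixMultiplication.Theorems.ObstructionCalculus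

open Literature.Computability.AlgebraicComplexity (actTensor)

section FibreLaw

variable {m : ℕ}

variable (m) in
/-- Tensors DOUBLY ISOLATED at `i₀`: a non-zero entry with first or second index `i₀` is the diagonal entry
`x_{i₀i₀i₀}` (the third-slot fibre `x_{ab i₀}`, `a, b ≠ i₀`, is unconstrained). [this node] -/
def twoSlotIsolated (i₀ : Fin m) : Set (Tensor ℂ m) :=
  {x | ∀ a b c : Fin m, x a b c ≠ 0 → (a = i₀ ∨ b = i₀) → a = i₀ ∧ b = i₀ ∧ c = i₀}

/-- Membership in `twoSlotIsolated`, unfolded. [bookkeeping] -/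
theorem mem_twoSlotIsolated {i₀ : Fin m} {x : Tensor ℂ m} : x ∈ twoSlotIsolated m i₀ ↔
    ∀ a b c : Fin m, x a b c ≠ 0 → (a = i₀ ∨ b = i₀) → a = i₀ ∧ b = i₀ ∧ c = i₀ := Iff.rfl

/-- Rescale the third-slot fibre over `i₀` (entries `x_{ab i₀}` with `(a,b) ≠ (i₀,i₀)`) by `l`. [this node] -/
def scaleFibre (i₀ : Fin m) (l : ℂ) (x : Tensor ℂ m) : Tensor ℂ m :=
  fun a b c => if c = i₀ ∧ ¬ (a = i₀ ∧ b = i₀) then l * x a b c else x a b c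

/-- Set the third-slot fibre over `i₀` to zero. [this node] -/
def zeroFibre (i₀ : Fin m) (x : Tensor ℂ m) : Tensor ℂ m :=
  fun a b c => if c = i₀ ∧ ¬ (a = i₀ ∧ b = i₀) then 0 else x a b c

/-- `scaleFibre` at `l = 0` is `zeroFibre`. [bookkeeping] -/
theorem scaleFibre_zero (i₀ : Fin m) (x : Tensor ℂ m) : scaleFibre i₀ 0 x = zeroFibre i₀ x := by
  funext a b c
  simp only [scaleFibre, zeroFibre, zero_mul]

/-- `scaleFibre` at `l = 1` is the identity. [bookkeeping] -/
theorem scaleFibre_one (i₀ : Fin m) (x : Tensor ℂ m) : scaleFibre i₀ 1 x = x := by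
  funext a b c
  simp only [scaleFibre, one_mul, ite_self]

/-- The one-parameter torus `D_l = diag(1,…,1,l,1,…,1)` (`l` at position `i₀`). [bookkeeping] -/
def fibreTorus (i₀ : Fin m) (l : ℂ) : Matrix (Fin m) (Fin m) ℂ :=
  Matrix.diagonal (Function.update (fun _ : Fin m => (1 : ℂ)) i₀ l)

/-- `D_l ∈ B_m` for `l ≠ 0`. [bookkeeping] -/
theorem fibreTorus_mem_borel (i₀ : Fin m) {l : ℂ} (hl : l ≠ 0) : fibreTorus i₀ l ∈ borel m :=
  diagonal_mem_borel fun i => by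
    rcases eq_or_ne i i₀ with rfl | h
    · rwa [Function.update_self]
    · rw [Function.update_of_ne h]
      exact one_ne_zero

/-- The character of `D_l`: `weightChar λ D_l = l^{λ_{i₀}}`. [bookkeeping] -/
theorem weightChar_fibreTorus (lam : Fin m → ℕ) (i₀ : Fin m) (l : ℂ) :
    weightChar lam (fibreTorus i₀ l) = l ^ lam i₀ := by
  unfold fibreTorus
  rw [weightChar_diagonal, Finset.prod_eq_single i₀]
  · rw [Function.update_self]
  · intro i _ hi
    rw [Function.update_of_ne hi, one_pow]
  · exact fun h => (h (Finset.mem_univ _)).elim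

/-- **The intertwining identity.** On a doubly isolated tensor, the third-slot torus `(1,1,D_l)` acts as the first-slot
torus `(D_l,1,1)` composed with the fibre rescaling: `(1,1,D_l)·x = (D_l,1,1)·(scaleFibre i₀ l x)`. [this node] -/
theorem actTensor_fibreTorus_eq {i₀ : Fin m} {x : Tensor ℂ m} (hx : x ∈ twoSlotIsolated m i₀) (l : ℂ) :
    actTensor (1 : Matrix (Fin m) (Fin m) ℂ) (1 : Matrix (Fin m) (Fin m) ℂ) (fibreTorus i₀ l) x =
      actTensor (fibreTorus i₀ l) (1 : Matrix (Fin m) (Fin m) ℂ) (1 : Matrix (Fin m) (Fin m) ℂ) (scaleFibre i₀ l x) := by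
  have h1 : (1 : Matrix (Fin m) (Fin m) ℂ) = Matrix.diagonal fun _ => 1 := Matrix.diagonal_one.symm
  unfold fibreTorus
  rw [h1, actTensor_diagonal, actTensor_diagonal]
  funext a b c
  simp only [one_mul, mul_one]
  by_cases hx0 : x a b c = 0
  · simp only [scaleFibre, hx0, mul_zero, ite_self]
  rcases eq_or_ne a i₀ with rfl | ha
  · obtain ⟨-, hb, hc⟩ := hx a b c hx0 (Or.inl rfl)
    subst hb
    subst hc
    simp only [scaleFibre, and_self, not_true_eq_false, and_false, if_false]
  · have hb : b ≠ i₀ := fun hb => ha (hx a b c hx0 (Or.inr hb)).1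
    rw [Function.update_of_ne ha, one_mul]
    by_cases hc : c = i₀
    · subst hc
      rw [Function.update_self, scaleFibre, if_pos ⟨rfl, fun h => ha h.1⟩]
    · rw [Function.update_of_ne hc, one_mul, scaleFibre, if_neg fun h => hc h.1]

/-- **H15a, torus form.** A weight vector with equal `i₀`-weights in slots `0` and `2` does not change under rescaling
the fibre of a doubly isolated point by `l ≠ 0`. [this node] -/
theorem evalT_scaleFibre {Λ : Fin 3 → Fin m → ℕ} {d : ℕ} {f : MvPolynomial (Idx m) ℂ} (hf : f ∈ hwvSpace Λ d)
    {i₀ : Fin m} (hΛ : Λ 0 i₀ = Λ 2 i₀) {x : Tensor ℂ m} (hx : x ∈ twoSlotIsolated m i₀) {l : ℂ} (hl : l ≠ 0) :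
    evalT (scaleFibre i₀ l x) f = evalT x f := by
  have hB := fibreTorus_mem_borel i₀ hl
  have h2 := hf.2 1 1 (fibreTorus i₀ l) one_mem_borel one_mem_borel hB x
  have h0 := hf.2 (fibreTorus i₀ l) 1 1 hB one_mem_borel one_mem_borel (scaleFibre i₀ l x)
  rw [actTensor_fibreTorus_eq hx, h0] at h2
  simp only [weightChar_one, weightChar_fibreTorus, hΛ, one_mul, mul_one] at h2
  exact mul_left_cancel₀ (pow_ne_zero _ hl) h2

/-- **H15a (fibre law).** A weight vector with equal `i₀`-weights in slots `0` and `2` takes the same value at a doubly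
isolated point and at the point with the fibre over `i₀` set to zero. [this node] -/
theorem evalT_zeroFibre {Λ : Fin 3 → Fin m → ℕ} {d : ℕ} {f : MvPolynomial (Idx m) ℂ} (hf : f ∈ hwvSpace Λ d)
    {i₀ : Fin m} (hΛ : Λ 0 i₀ = Λ 2 i₀) {x : Tensor ℂ m} (hx : x ∈ twoSlotIsolated m i₀) :
    evalT (zeroFibre i₀ x) f = evalT x f := by
  classical
  -- the one-variable polynomial `P(l) = f(scaleFibre i₀ l x)`
  let g : Idx m → Polynomial ℂ := fun p =>
    if p.2.2 = i₀ ∧ ¬ (p.1 = i₀ ∧ p.2.1 = i₀) then Polynomial.C (x p.1 p.2.1 p.2.2) * Polynomial.X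
    else Polynomial.C (x p.1 p.2.1 p.2.2)
  let P : Polynomial ℂ := MvPolynomial.aeval g f
  have hPeval : ∀ l : ℂ, P.eval l = evalT (scaleFibre i₀ l x) f := by
    intro l
    show Polynomial.eval l (MvPolynomial.aeval g f) = _
    rw [← Polynomial.coe_aeval_eq_eval, ← AlgHom.comp_apply, MvPolynomial.comp_aeval]
    unfold evalT
    refine congrArg (fun F : Idx m → ℂ => (MvPolynomial.aeval F) f) (funext fun p => ?_)
    show (Polynomial.aeval l) (g p) = scaleFibre i₀ l x p.1 p.2.1 p.2.2
    simp only [g, scaleFibre]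
    split_ifs <;> simp only [map_mul, Polynomial.aeval_C, Polynomial.aeval_X, Algebra.algebraMap_self,
      RingHom.id_apply, mul_comm]
  have hzero : P - Polynomial.C (evalT x f) = 0 := by
    apply Polynomial.eq_zero_of_infinite_isRoot
    refine Set.Infinite.mono (s := {l : ℂ | l ≠ 0}) (fun l hl => ?_) ?_
    · rw [Set.mem_setOf_eq, Polynomial.IsRoot, Polynomial.eval_sub, Polynomial.eval_C, hPeval,
        evalT_scaleFibre hf hΛ hx hl, sub_self]
    · have : ({l : ℂ | l ≠ 0}) = ({0} : Set ℂ)ᶜ := by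
        ext l
        simp
      rw [this]
      exact (Set.finite_singleton 0).infinite_compl
  have h0 := congrArg (Polynomial.eval 0) hzero
  rw [Polynomial.eval_sub, Polynomial.eval_C, Polynomial.eval_zero, sub_eq_zero, hPeval,
    scaleFibre_zero] at h0
  exact h0

/-- H15a for the rectangular types: `f(zeroFibre i₀ x) = f(x)` for every `((k^N))³`-weight vector (any degree `d`,
any `i₀`). [this node] -/
theorem evalT_zeroFibre_rect {N k d : ℕ} {f : MvPolynomial (Idx m) ℂ} (hf : f ∈ hwvSpace (rectType m N k) d)
    {i₀ : Fin m} {x : Tensor ℂ m} (hx : x ∈ twoSlotIsolated m i₀) :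
    evalT (zeroFibre i₀ x) f = evalT x f :=
  evalT_zeroFibre hf rfl hx

/-- **Level sets do not see the fibre**: `E′_N(zeroFibre i₀ x) = E′_N(x)` for doubly isolated `x`. [this node] -/
theorem pointLevels_zeroFibre (N : ℕ) {i₀ : Fin m} {x : Tensor ℂ m} (hx : x ∈ twoSlotIsolated m i₀) :
    pointLevels N (zeroFibre i₀ x) = pointLevels N x := by
  ext k
  refine exists_congr fun f => and_congr_right fun hf => ?_
  rw [evalT_zeroFibre_rect hf hx]

/-- For the last index `i₀ = m-1`, zeroing the fibre of a doubly isolated tensor produces a genuine `((m-1),1)`-BLOCK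
point (`blockDiag m 1`: every non-zero entry has its indices all equal to `m-1` or all below). [this node] -/
theorem zeroFibre_mem_blockDiag_one {i₀ : Fin m} (hi₀ : m ≤ (i₀ : ℕ) + 1) {x : Tensor ℂ m}
    (hx : x ∈ twoSlotIsolated m i₀) : zeroFibre i₀ x ∈ blockDiag m 1 := by
  have key : ∀ a : Fin m, m ≤ (a : ℕ) + 1 ↔ a = i₀ := fun a =>
    ⟨fun h => Fin.ext (by have := a.2; have := i₀.2; omega), fun h => h ▸ hi₀⟩
  intro a b c hne
  simp only [key]
  by_cases hfib : c = i₀ ∧ ¬ (a = i₀ ∧ b = i₀)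
  · exact (hne (by rw [zeroFibre, if_pos hfib])).elim
  rw [zeroFibre, if_neg hfib] at hne
  by_cases hab : a = i₀ ∨ b = i₀
  · exact Or.inl (hx a b c hne hab)
  · rw [not_or] at hab
    exact Or.inr ⟨hab.1, hab.2, fun hc => hfib ⟨hc, fun h => hab.1 h.1⟩⟩

/-- **Doubly isolated points are block points in disguise**: for `i₀ = m-1`, the level set of a doubly isolated `x` is
the level set of the `((m-1),1)`-block point `zeroFibre i₀ x`. [this node] -/
theorem pointLevels_eq_of_twoSlotIsolated (N : ℕ) {i₀ : Fin m} (hi₀ : m ≤ (i₀ : ℕ) + 1) {x : Tensor ℂ m}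
    (hx : x ∈ twoSlotIsolated m i₀) :
    ∃ y ∈ blockDiag m 1, pointLevels N x = pointLevels N y :=
  ⟨zeroFibre i₀ x, zeroFibre_mem_blockDiag_one hi₀ hx, (pointLevels_zeroFibre N hx).symm⟩

end FibreLaw

end Summit.MatrixMultiplication.MatrixMultiplication.Theorems.ObstructionCalculus
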